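import Literature.MathematicalPhysics.QuantumFieldTheory.Balaban1983to89.B8Eq131CubesRec
import Literature.MathematicalPhysics.QuantumFieldTheory.Balaban1983to89.B8CubeMemberZd

/-!
# `Balaban1983to89.B8CubeMemberZdRec` — [Balaban1985RegularSpaces] Sect. F pp. 98–99: THE CUBE FAMILY `{□_j}_{j=0}^{k}` OF (1.131) FOR THE RECORD's CENTRED TOWER
# ([Balaban1987RG1] (0.3)): print's `Λ_j` ((1.5)), the truncations ((1.68) «taking Λ_{k−1} ∪ B(Λ_k) as Λ_{k−1}») and their first laws — §1 of the record twin of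
# `B8CubeMemberZd` (the geometry hub of road R6 (a); LEAD PEN dag-n05-e)

statement-level skeleton of published theorems with citation tags; proofs where landed; nothing here is a claim about the Yang–Mills mass gap

CITATION HEADER (lean-in-tree rule).  Cell `pub-ymgap` (HUMAN RULING D-0062), «N05-REC» road (director-ym №254∕№255; LEAD PEN dag-n05-e g37; desk `R6-PLAN.md` §2 (a); `N05-REC-INVENTORY.md`
§R6 row `B8CubeMemberZd`; dag-n07-w3's `Node00/CarriersB8CubeDentedRec` header: «`lamS_of_succ_lt ∕ lamS_top_subset`, which read n05-c's `cubeLam ∕ cubeLamS` — not yet twinned — are left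
to `B8CubeMemberZdRec`»).  [6] = [Balaban1985RegularSpaces] (1.5)–(1.6) p. 77, (1.68) p. 88, (1.131) p. 99 (`paper:balaban1985-cmp99-regular-spaces`); [I] = [Balaban1987RG1] (0.3) p. 252.
`--kind definition --supports stmt-QuantumFields-20541` (K0⁷; count-neutral; TWO `def`s `cubeLamZ`, `cubeLamSZ`).  TOKEN MAP (T2): the level-`j` label boxes `sqLo ∕ sqHi ∕ inLo ∕ inHi ↦
sqLoZ ∕ sqHiZ ∕ inLoZ ∕ inHiZ` and `LamP ↦ LamPZ` of dag-n05-d's `B8Eq131CubesRec` (centred blow-ups); statements and proofs otherwise the engine's §1 verbatim.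

WHAT IS DEFINED ∕ PROVED (sorry-free).  `cubeLamZ` ((1.5) for the record cube family: `Λ_j = □_j^{(j)} ∖ □_{j+1}^{(j)}`, `Λ_k = □_k^{(k)}`), `cubeLamZ_eq_LamPZ` (`= Λ′_j` of (1.131) for `1 ≤ j`),
`cubeLamSZ` (the level-`m` truncation (1.68)), `cubeLamSZ_of_lt ∕ _self ∕ _of_gt ∕ _top`, `inBox_sq_of_mem_cubeLamSZ` (`Λ_j ⊂ □_j^{(j)}`), `cubeLamSZ_succ_lt_iff` (the shape n07-w3's
`CubeB8DZ.lamS` reads below the top), `cubeLamZ_top_iff`.  NOT HERE (successor files of (a)): the cover lemma (1.6) with `UnderZ ∕ flmZ`, `inAxZ_cubeLamS_of_inAxOneZ`,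
`h135_of_cond166CubeZ_one`, the bond classes `cubeLamB` (they read the leaf-model currency still to be fixed with R5).
HONEST SCOPE.  Set bookkeeping; no estimate; nothing of [6]∕[I] asserted; `HThm4Rec` UNDISCHARGED; N05 ∕ N07 NOT discharged; counts unmoved (typed 28∕28 · discharged 8∕28); one finite 𝕋⁴
programme at fixed ε — nothing continuum ∕ ℝ⁴ ∕ OS ∕ mass gap ∕ Clay.  Two `def`s, no `instance`, no `notation`, no `sorry`.
-/

noncomputable section

namespace Literature.MathematicalPhysics.QuantumFieldTheory.Balaban1983to89.B8CubeMemberZdRec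

open B7Prop1Local (InBox)
open B8Eq131CubesRec (sqLoZ sqHiZ inLoZ inHiZ LamPZ)

export B7Prop1Explicit (Site)

variable {d : ℕ}

/-! ## §1 Print's `Λ_j` of the record cube family ((1.5)), the truncations ((1.68)) -/

/-- (RECORD TWIN of `B8CubeMemberZd.cubeLam`.) **(1.5) for the record cube family `{□_j}_{j=0}^{k}`** (centred tower): `Λ_j = □_j^{(j)} ∖ □_{j+1}^{(j)}` for `j < k`, `Λ_k = □_k^{(k)}`, as sets
of level-`j` labels (`□_j^{(j)} = [sqLoZ j, sqHiZ j]`, `□_{j+1}^{(j)} = [inLoZ j, inHiZ j]`).  For `1 ≤ j` this is print's `Λ′_j` of (1.131) (`LamPZ`).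
[cite: Balaban1985RegularSpaces, (1.5) p.77, (1.131) p.99; Balaban1987RG1, (0.3) p.252] -/
def cubeLamZ (L : ℕ) (a : Site d) (M ρ k j : ℕ) : Set (Site d) :=
  {z | InBox (sqLoZ L a ρ k j) (sqHiZ L a M ρ k j) z ∧ (j < k → ¬ InBox (inLoZ L a ρ k j) (inHiZ L a M ρ k j) z)}

/-- `cubeLamZ` IS print's `Λ′_j` of (1.131) for the record tower (`B8Eq131CubesRec.LamPZ`) for `1 ≤ j`. [cite: Balaban1985RegularSpaces, (1.131) p.99] -/
theorem cubeLamZ_eq_LamPZ (L : ℕ) (a : Site d) (M ρ k : ℕ) {j : ℕ} (hj : 1 ≤ j) :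
    cubeLamZ L a M ρ k j = LamPZ L a M ρ k j := by
  have hj0 : j ≠ 0 := by omega
  ext z
  simp only [cubeLamZ, LamPZ, if_neg hj0, Set.mem_setOf_eq]

/-- At the top level `Λ_k = □_k^{(k)}` (no inner box is removed). [cite: Balaban1985RegularSpaces, (1.5) p.77, (1.131) p.99 («Λ′_k = □_k^{(k)}»)] -/
theorem cubeLamZ_top_iff (L : ℕ) (a : Site d) (M ρ k : ℕ) (z : Site d) :
    z ∈ cubeLamZ L a M ρ k k ↔ InBox (sqLoZ L a ρ k k) (sqHiZ L a M ρ k k) z := by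
  simp only [cubeLamZ, Set.mem_setOf_eq, lt_self_iff_false, IsEmpty.forall_iff, and_true]

/-- (RECORD TWIN of `B8CubeMemberZd.cubeLamS`.) **The level-`m` TRUNCATION of the restriction sets** (p. 88, (1.68) «taking Λ_{k−1} ∪ B(Λ_k) as Λ_{k−1}», iterated): `Λ_j` for `j < m`,
`Ω_m^{(m)} = □_m^{(m)}` at `j = m`, `∅` above `m` — record tower. [cite: Balaban1985RegularSpaces, (1.68) p.88, (1.6) p.77; Balaban1987RG1, (0.3) p.252] -/
def cubeLamSZ (L : ℕ) (a : Site d) (M ρ k m j : ℕ) : Set (Site d) :=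
  if j < m then cubeLamZ L a M ρ k j
  else if j = m then {z | InBox (sqLoZ L a ρ k j) (sqHiZ L a M ρ k j) z} else ∅

/-- Below the truncation level the restriction sets are print's `Λ_j`. [cite: Balaban1985RegularSpaces, (1.68) p.88] -/
theorem cubeLamSZ_of_lt (L : ℕ) (a : Site d) (M ρ k : ℕ) {m j : ℕ} (hj : j < m) :
    cubeLamSZ L a M ρ k m j = cubeLamZ L a M ρ k j := by
  simp [cubeLamSZ, hj]

/-- At the truncation level the restriction set is the whole traced cube `□_m^{(m)} = Ω_m^{(m)}`. [cite: Balaban1985RegularSpaces, (1.68) p.88, (1.6) p.77] -/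
theorem cubeLamSZ_self (L : ℕ) (a : Site d) (M ρ k m : ℕ) :
    cubeLamSZ L a M ρ k m m = {z | InBox (sqLoZ L a ρ k m) (sqHiZ L a M ρ k m) z} := by
  simp [cubeLamSZ]

/-- Above the truncation level `m` there are no restriction sets. [cite: Balaban1985RegularSpaces, (1.68) p.88] -/
theorem cubeLamSZ_of_gt (L : ℕ) (a : Site d) (M ρ k : ℕ) {m j : ℕ} (hj : m < j) :
    cubeLamSZ L a M ρ k m j = ∅ := by
  have h1 : ¬ j < m := by omega
  have h2 : j ≠ m := by omega
  simp [cubeLamSZ, h1, h2]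

/-- **No truncation at `m = k`**: `cubeLamSZ … k j = Λ_j` for every `j ≤ k`. [cite: Balaban1985RegularSpaces, (1.5) p.77, (1.131) p.99] -/
theorem cubeLamSZ_top (L : ℕ) (a : Site d) (M ρ : ℕ) {k j : ℕ} (hj : j ≤ k) :
    cubeLamSZ L a M ρ k k j = cubeLamZ L a M ρ k j := by
  rcases Nat.lt_or_ge j k with h | h
  · exact cubeLamSZ_of_lt L a M ρ k h
  · have hjk : j = k := le_antisymm hj h
    subst hjk
    rw [cubeLamSZ_self]
    ext z
    simp only [cubeLamZ, Set.mem_setOf_eq, lt_self_iff_false, IsEmpty.forall_iff, and_true]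

/-- Every restriction site of a truncation lies in the traced cube of its level: `cubeLamSZ … m j ⊂ □_j^{(j)}` (`Λ_j ⊂ Ω_j^{(j)}`, (1.5)).
[cite: Balaban1985RegularSpaces, (1.5) p.77, (1.131) p.99] -/
theorem inBox_sq_of_mem_cubeLamSZ {L : ℕ} {a : Site d} {M ρ k m j : ℕ} {z : Site d} (hz : z ∈ cubeLamSZ L a M ρ k m j) :
    InBox (sqLoZ L a ρ k j) (sqHiZ L a M ρ k j) z := by
  rcases lt_trichotomy j m with h | h | h
  · rw [cubeLamSZ_of_lt L a M ρ k h] at hz; exact hz.1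
  · subst h; rw [cubeLamSZ_self] at hz; exact hz
  · rw [cubeLamSZ_of_gt L a M ρ k h] at hz; exact absurd hz (Set.notMem_empty _)

/-- Below the top (`j < k`, `j < m`) membership in the truncated restriction set is «in the label box of `□_j`, not in the label box of `□_{j+1}`» — the two conjuncts dag-n07-w3's
`Node00.CubeB8DZ.lamS` reads below the top level. [cite: Balaban1985RegularSpaces, (1.5) p.77, (1.131) p.99; Balaban1985Variational, (148) p.301] -/
theorem cubeLamSZ_lt_iff (L : ℕ) (a : Site d) (M ρ : ℕ) {k m j : ℕ} (hjm : j < m) (hjk : j < k) (z : Site d) :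
    z ∈ cubeLamSZ L a M ρ k m j ↔ InBox (sqLoZ L a ρ k j) (sqHiZ L a M ρ k j) z ∧ ¬ InBox (inLoZ L a ρ k j) (inHiZ L a M ρ k j) z := by
  rw [cubeLamSZ_of_lt L a M ρ k hjm]
  simp only [cubeLamZ, Set.mem_setOf_eq]
  exact ⟨fun h => ⟨h.1, h.2 hjk⟩, fun h => ⟨h.1, fun _ => h.2⟩⟩

/-- The truncations are nested in the truncation level only through the top set: for `j < m ≤ m′` the level-`j` sets agree (`= Λ_j`). [cite: Balaban1985RegularSpaces, (1.68) p.88] -/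
theorem cubeLamSZ_of_lt_eq (L : ℕ) (a : Site d) (M ρ k : ℕ) {m m' j : ℕ} (hjm : j < m) (hjm' : j < m') :
    cubeLamSZ L a M ρ k m j = cubeLamSZ L a M ρ k m' j := by
  rw [cubeLamSZ_of_lt L a M ρ k hjm, cubeLamSZ_of_lt L a M ρ k hjm']

end Literature.MathematicalPhysics.QuantumFieldTheory.Balaban1983to89.B8CubeMemberZdRec
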